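import Mathlib
import HarnessLib
import Literature.MathematicalPhysics.QuantumLattice.HubbardGridTadpoleFlow
import Literature.MathematicalPhysics.QuantumLattice.GrassmannLaplacianPairWick
import Literature.MathematicalPhysics.QuantumLattice.GrassmannIntegrationByParts
import Literature.MathematicalPhysics.QuantumLattice.GrassmannIntegral
import Literature.MathematicalPhysics.QuantumLattice.GrassmannLaplacianGramBound
import Summits.HubbardSuperconductivity.HubbardSuperconductivity.Theorems.KLProgrammeKLRegimeEngineScaleZeroTwoLegTadpoleSupport
import Summits.HubbardSuperconductivity.HubbardSuperconductivity.Theorems.KLProgrammeKLRegimeWickBubbleColourings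

/-!
# Route `KLProgramme`, crux K3 — gen-8 ENGINE-FLOW child (stmt-HubbardSuperconductivity-20437 `KLRegimeEngineV17F2`), stub (C)
# `stub_twoLeg_curvature` at `n = 0`, located item #22 «(C)-SCALE0-PT2», step (π1a): Wick's rule for the TWO-WORD monomial of the grid
# interaction with one `ψ⁺` and one `ψ⁻` leg amputated at DIFFERENT grid points

Seat hubbard-kl-k3c5-p1 (g13; owner of #22).  The natural-size supplier of the n = 0 two-leg reading must see the scale-`0` grid output
`W₀ = effAction (S_{4M}ᵀ C⁰_{>e₀} S_{4M}) V_{4M}` through second order EXPLICITLY (memo HOME/hubbard-kl-k3c5-p1/g13/SCALE0-PT2-SIZING.md): the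
off-diagonal two-leg kernel of the second cumulant `e^{Δ}(V²) − (e^{Δ}V)²` is the sunset plus the Hartree chain.  This file is the generic
Grassmann layer of that computation, for an ARBITRARY charge-conserving, spin-diagonal covariance `C` on the grid legs:

* §1 `kernel_gaussConv_eq_gaussExpect_iterDeriv` — kernels of a Gaussian convolution are Gaussian expectations of iterated derivatives,
  `kernel (μ_C ⋆ F) m X = (m!)⁻¹ ∫dμ_C ∂_{X_{m−1}}⋯∂_{X_0}F` (derivatives commute with `e^{Δ_C}`, `grassmannDeriv_gaussConv`);
* §2 the two external derivatives of the two-word monomial `w_p w_q = ψ⁺↑ψ⁻↑ψ⁺↓ψ⁻↓(p)·ψ⁺↑ψ⁻↑ψ⁺↓ψ⁻↓(q)`, `p ≠ q`, at `ψ⁺_{pσ}` and `ψ⁻_{qσ}`: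
  a PAIRED monomial of three `ψ⁺ψ⁻` pairs up to sign (`iterDeriv_two_gridWord_mul_gridWord_up/_down`), zero when a leg sits at a third point;
* §3 Wick's determinant rule (`gaussExpect_genPairProd`) on it: **`gaussExpect_iterDeriv_two_gridWord_mul_gridWord`** —
  `∫dμ_C ∂_{ψ⁻_{qσ}}∂_{ψ⁺_{pσ}}(w_p w_q) = A(qσ⁺,pσ⁻)·(A(pσ̄⁺,qσ̄⁻)A(qσ̄⁺,pσ̄⁻) − A(pσ̄⁺,pσ̄⁻)A(qσ̄⁺,qσ̄⁻))`, `A = contr C`: the `3 × 3`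
  determinant has four spin-forbidden zeros and factors as (connecting line) × (SUNSET bubble − product of the two TADPOLES).

Pure Grassmann algebra; no definitions; nothing about the Hubbard model's sizes, no stub of 20437, K3 or superconductivity is asserted.
References: Salmhofer 1999 §4.3 (4.86), App. B.5 [cite: Salmhofer1999]; Feldman–Knörrer–Trubowitz 2002 Prop. I.18 [cite: FeldmanKnorrerTrubowitz2002];
BGM 2006 §2.2 (2.12)–(2.14) [cite: BenfattoGiulianiMastropietro2006].
-/

noncomputable section

namespace Summit.HubbardSuperconductivity.HubbardSuperconductivity.Theorems.KLRegimeSplit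

set_option linter.dupNamespace false -- summit = problem name (single-conjunct summit), D-0017

open Literature.MathematicalPhysics.QuantumLattice Literature.Probability.LatticeModels GrassmannAlgebra Finset Matrix
open Summit.HubbardSuperconductivity.HubbardSuperconductivity.Theorems.EngineV8
open Summit.HubbardSuperconductivity.HubbardSuperconductivity.Theorems.KLRegimeWick (iterDeriv_two)

/-! ## §1 Kernels of a Gaussian convolution -/

section Generic

variable (R : Type*) [CommRing R] {Γ : Type*}

omit [CommRing R] in
/-- `iterDeriv` as a mapped list product. -/
theorem iterDeriv_eq_listProd [CommRing R] {m : ℕ} (X : Fin m → Γ) :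
    iterDeriv R X = (((List.ofFn X).reverse).map fun Y => grassmannDeriv R Y).prod := by
  rw [iterDeriv, List.map_reverse, List.map_ofFn]
  rfl

/-- Moving a generator left past another inside a right-nested product: `ψ_x (ψ_y R) = −ψ_y (ψ_x R)`. -/
theorem gen_mul_gen_mul_swap [DecidableEq Γ] (x y : Γ) (a : GrassmannAlgebra R Γ) :
    gen R x * (gen R y * a) = -(gen R y * (gen R x * a)) := by
  rw [← mul_assoc, GrassmannAlgebra.gen_mul_gen, neg_mul, mul_assoc]

variable [Algebra ℚ R] [Fintype Γ]

/-- A product of field derivatives commutes with the Gaussian convolution. -/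
theorem listProd_grassmannDeriv_gaussConv (C : Matrix Γ Γ R) (l : List Γ) (F : GrassmannAlgebra R Γ) :
    (l.map fun Y => grassmannDeriv R Y).prod (gaussConv R C F) = gaussConv R C ((l.map fun Y => grassmannDeriv R Y).prod F) := by
  induction l with
  | nil => simp
  | cons Y l ih =>
    rw [List.map_cons, List.prod_cons, Module.End.mul_apply, Module.End.mul_apply, ih, grassmannDeriv_gaussConv]

/-- **Iterated derivatives commute with the Gaussian convolution**: `∂_X (μ_C ⋆ F) = μ_C ⋆ (∂_X F)`. -/
theorem iterDeriv_gaussConv {m : ℕ} (C : Matrix Γ Γ R) (X : Fin m → Γ) (F : GrassmannAlgebra R Γ) :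
    iterDeriv R X (gaussConv R C F) = gaussConv R C (iterDeriv R X F) := by
  rw [iterDeriv_eq_listProd, listProd_grassmannDeriv_gaussConv]

/-- **Kernels of a Gaussian convolution are Gaussian expectations of derivatives**:
`kernel (μ_C ⋆ F) m X = (m!)⁻¹ · ∫dμ_C (∂_{X_{m-1}}⋯∂_{X_0} F)`. -/
theorem kernel_gaussConv_eq_gaussExpect_iterDeriv [DecidableEq Γ] (C : Matrix Γ Γ R) (F : GrassmannAlgebra R Γ) (m : ℕ) (X : Fin m → Γ) :
    kernel R (gaussConv R C F) m X = ((m.factorial : ℚ)⁻¹ • (1 : R)) * gaussExpect R C (iterDeriv R X F) := by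
  rw [kernel_def, iterDeriv_gaussConv, gaussExpect_apply]

end Generic

/-! ## §2 The two-word monomial with two legs amputated -/

section Grid

variable {L N : ℕ}

/-- **Two external derivatives of the two-word monomial**, spin `↑`: for `p ≠ q`,
`∂_{ψ⁻_{q↑}} ∂_{ψ⁺_{p↑}} (w_p w_q) = −ψ⁺_{q↑}ψ⁻_{p↑}·ψ⁺_{p↓}ψ⁻_{p↓}·ψ⁺_{q↓}ψ⁻_{q↓}` (a paired monomial). -/
theorem iterDeriv_two_gridWord_mul_gridWord_up (p q : GridPoint L N) (hpq : p ≠ q) :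
    iterDeriv ℂ ![(((p, 0), 0) : GridLeg (GridPoint L N)), ((q, 0), 1)] (gridWord L N p * gridWord L N q) =
      -genPairProd ℂ ![(((q, 0), 0) : GridLeg (GridPoint L N)), ((p, 1), 0), ((q, 1), 0)]
        ![(((p, 0), 1) : GridLeg (GridPoint L N)), ((p, 1), 1), ((q, 1), 1)] := by
  have hqp : q ≠ p := fun h => hpq h.symm
  rw [iterDeriv_two]
  simp only [gridWord, mul_assoc]
  simp only [grassmannDeriv_gen_mul, grassmannDeriv_gen, Prod.mk.injEq, hpq, hqp, and_true, and_false,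
    if_true, if_false, and_self, one_ne_zero, zero_ne_one, mul_zero, sub_zero, zero_sub, mul_neg, neg_neg]
  -- reorder `ψ⁻_{p↑} ψ⁺_{p↓} ψ⁻_{p↓} ψ⁺_{q↑} (ψ⁺_{q↓} ψ⁻_{q↓})` into the paired form (move `ψ⁺_{q↑}` to the front: three transpositions)
  simp only [genPairProd, List.ofFn_succ, List.ofFn_zero, Matrix.cons_val_zero, Matrix.cons_val_succ, List.prod_cons, List.prod_nil,
    mul_one, mul_assoc]
  rw [gen_mul_gen_mul_swap ℂ (((p, 1), 1) : GridLeg (GridPoint L N)) ((q, 0), 0), mul_neg,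
    gen_mul_gen_mul_swap ℂ (((p, 1), 0) : GridLeg (GridPoint L N)) ((q, 0), 0), neg_neg,
    gen_mul_gen_mul_swap ℂ (((p, 0), 1) : GridLeg (GridPoint L N)) ((q, 0), 0)]

/-- **Two external derivatives of the two-word monomial**, spin `↓`: for `p ≠ q`,
`∂_{ψ⁻_{q↓}} ∂_{ψ⁺_{p↓}} (w_p w_q) = −ψ⁺_{p↑}ψ⁻_{p↑}·ψ⁺_{q↓}ψ⁻_{p↓}·ψ⁺_{q↑}ψ⁻_{q↑}` (a paired monomial). -/
theorem iterDeriv_two_gridWord_mul_gridWord_down (p q : GridPoint L N) (hpq : p ≠ q) :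
    iterDeriv ℂ ![(((p, 1), 0) : GridLeg (GridPoint L N)), ((q, 1), 1)] (gridWord L N p * gridWord L N q) =
      -genPairProd ℂ ![(((p, 0), 0) : GridLeg (GridPoint L N)), ((q, 1), 0), ((q, 0), 0)]
        ![(((p, 0), 1) : GridLeg (GridPoint L N)), ((p, 1), 1), ((q, 0), 1)] := by
  have hqp : q ≠ p := fun h => hpq h.symm
  rw [iterDeriv_two]
  simp only [gridWord, mul_assoc]
  simp only [grassmannDeriv_gen_mul, grassmannDeriv_gen, Prod.mk.injEq, hpq, hqp, and_true, and_false,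
    if_true, if_false, and_self, one_ne_zero, zero_ne_one, mul_zero, sub_zero, zero_sub, mul_neg, neg_neg]
  -- reorder `ψ⁺_{p↑} ψ⁻_{p↑} ψ⁻_{p↓} ψ⁺_{q↑} ψ⁻_{q↑} ψ⁺_{q↓}` (move `ψ⁺_{q↓}` left past three fields)
  simp only [genPairProd, List.ofFn_succ, List.ofFn_zero, Matrix.cons_val_zero, Matrix.cons_val_succ, List.prod_cons, List.prod_nil,
    mul_one, mul_assoc]
  rw [GrassmannAlgebra.gen_mul_gen ℂ (((q, 0), 1) : GridLeg (GridPoint L N)) ((q, 1), 0)]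
  simp only [mul_neg]
  rw [gen_mul_gen_mul_swap ℂ (((q, 0), 0) : GridLeg (GridPoint L N)) ((q, 1), 0)]
  simp only [mul_neg, neg_neg]
  rw [gen_mul_gen_mul_swap ℂ (((p, 1), 1) : GridLeg (GridPoint L N)) ((q, 1), 0)]
  simp only [mul_neg]

/-- **A derivative at a third point kills the two-word monomial**: `∂_{ψ^c_{r s}} (w_p w_q) = 0` for `r ∉ {p, q}`. -/
theorem grassmannDeriv_gridWord_mul_gridWord_eq_zero (p q r : GridPoint L N) (hrp : r ≠ p) (hrq : r ≠ q) (s c : Fin 2) :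
    grassmannDeriv ℂ (((r, s), c) : GridLeg (GridPoint L N)) (gridWord L N p * gridWord L N q) = 0 := by
  simp only [gridWord, mul_assoc]
  simp only [grassmannDeriv_gen_mul, grassmannDeriv_gen, Prod.mk.injEq, hrp, hrq, false_and, if_false, mul_zero, sub_zero]

/-- Hence both external derivatives vanish unless `{p, q}` are the two external points: first leg. -/
theorem iterDeriv_two_gridWord_mul_gridWord_eq_zero_left (p q p₀ q₀ : GridPoint L N) (h : p₀ ≠ p) (h' : p₀ ≠ q) (σ : Fin 2) :
    iterDeriv ℂ ![(((p₀, σ), 0) : GridLeg (GridPoint L N)), ((q₀, σ), 1)] (gridWord L N p * gridWord L N q) = 0 := by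
  rw [iterDeriv_two, grassmannDeriv_gridWord_mul_gridWord_eq_zero p q p₀ h h', map_zero]

/-- Second leg. -/
theorem iterDeriv_two_gridWord_mul_gridWord_eq_zero_right (p q p₀ q₀ : GridPoint L N) (h : q₀ ≠ p) (h' : q₀ ≠ q) (σ : Fin 2) :
    iterDeriv ℂ ![(((p₀, σ), 0) : GridLeg (GridPoint L N)), ((q₀, σ), 1)] (gridWord L N p * gridWord L N q) = 0 := by
  rw [iterDeriv_two, grassmannDeriv_grassmannDeriv_comm, grassmannDeriv_gridWord_mul_gridWord_eq_zero p q q₀ h h', map_zero, neg_zero]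

/-- The two grid words commute (even elements). -/
theorem gridWord_mul_comm (p q : GridPoint L N) : gridWord L N p * gridWord L N q = gridWord L N q * gridWord L N p := by
  have hp : gridWord L N p ∈ evenOdd ℂ (0 : ZMod 2) := by
    have h : gridWord L N p = genPairProd ℂ ![(((p, 0), 0) : GridLeg (GridPoint L N)), ((p, 1), 0)]
        ![(((p, 0), 1) : GridLeg (GridPoint L N)), ((p, 1), 1)] := by
      simp [gridWord, genPairProd, List.ofFn_succ, mul_assoc]
    rw [h]
    exact genPairProd_mem_evenOdd_zero ℂ _ _
  exact (commute_of_mem_evenOdd_zero ℂ hp _).eq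

end Grid

/-! ## §3 Wick's determinant for the derived two-word monomial -/

section Wick

variable {L N : ℕ} [NeZero L] (C : Matrix (GridLeg (GridPoint L N)) (GridLeg (GridPoint L N)) ℂ)
  (hcharge : ∀ X Y : GridLeg (GridPoint L N), X.2 = Y.2 → contr ℂ C X Y = 0)
  (hspin : ∀ X Y : GridLeg (GridPoint L N), X.1.2 ≠ Y.1.2 → contr ℂ C X Y = 0)
include hcharge hspin

/-- **The Gaussian expectation of the derived two-word monomial, spin `↑`** (Wick's determinant rule for a charge-conserving,
spin-diagonal covariance): `∫dμ_C ∂_{ψ⁻_{q↑}}∂_{ψ⁺_{p↑}}(w_p w_q) = A(q↑⁺,p↑⁻)·(A(p↓⁺,q↓⁻)A(q↓⁺,p↓⁻) − A(p↓⁺,p↓⁻)A(q↓⁺,q↓⁻))`,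
`A = contr C` — SUNSET minus HARTREE CHAIN. -/
theorem gaussExpect_iterDeriv_two_gridWord_mul_gridWord_up (p q : GridPoint L N) (hpq : p ≠ q) :
    gaussExpect ℂ C (iterDeriv ℂ ![(((p, 0), 0) : GridLeg (GridPoint L N)), ((q, 0), 1)] (gridWord L N p * gridWord L N q)) =
      contr ℂ C (((q, 0), 0) : GridLeg (GridPoint L N)) ((p, 0), 1) *
        (contr ℂ C (((p, 1), 0) : GridLeg (GridPoint L N)) ((q, 1), 1) * contr ℂ C (((q, 1), 0) : GridLeg (GridPoint L N)) ((p, 1), 1) -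
          contr ℂ C (((p, 1), 0) : GridLeg (GridPoint L N)) ((p, 1), 1) * contr ℂ C (((q, 1), 0) : GridLeg (GridPoint L N)) ((q, 1), 1)) := by
  rw [iterDeriv_two_gridWord_mul_gridWord_up p q hpq, map_neg, gaussExpect_genPairProd ℂ C _ _ (fun i j => hcharge _ _ (by
    fin_cases i <;> fin_cases j <;> rfl)), Matrix.det_fin_three]
  have z01 : contr ℂ C (((q, 0), 0) : GridLeg (GridPoint L N)) ((p, 1), 1) = 0 := hspin _ _ (by simp)
  have z02 : contr ℂ C (((q, 0), 0) : GridLeg (GridPoint L N)) ((q, 1), 1) = 0 := hspin _ _ (by simp)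
  have z10 : contr ℂ C (((p, 1), 0) : GridLeg (GridPoint L N)) ((p, 0), 1) = 0 := hspin _ _ (by simp)
  have z20 : contr ℂ C (((q, 1), 0) : GridLeg (GridPoint L N)) ((p, 0), 1) = 0 := hspin _ _ (by simp)
  simp only [Matrix.of_apply, Matrix.cons_val_zero, Matrix.cons_val_one, Matrix.cons_val_two, Matrix.head_cons, Matrix.tail_cons,
    z01, z02, z10, z20]
  ring

/-- **The same, spin `↓`**: `∫dμ_C ∂_{ψ⁻_{q↓}}∂_{ψ⁺_{p↓}}(w_p w_q) = A(q↓⁺,p↓⁻)·(A(p↑⁺,q↑⁻)A(q↑⁺,p↑⁻) − A(p↑⁺,p↑⁻)A(q↑⁺,q↑⁻))`. -/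
theorem gaussExpect_iterDeriv_two_gridWord_mul_gridWord_down (p q : GridPoint L N) (hpq : p ≠ q) :
    gaussExpect ℂ C (iterDeriv ℂ ![(((p, 1), 0) : GridLeg (GridPoint L N)), ((q, 1), 1)] (gridWord L N p * gridWord L N q)) =
      contr ℂ C (((q, 1), 0) : GridLeg (GridPoint L N)) ((p, 1), 1) *
        (contr ℂ C (((p, 0), 0) : GridLeg (GridPoint L N)) ((q, 0), 1) * contr ℂ C (((q, 0), 0) : GridLeg (GridPoint L N)) ((p, 0), 1) -
          contr ℂ C (((p, 0), 0) : GridLeg (GridPoint L N)) ((p, 0), 1) * contr ℂ C (((q, 0), 0) : GridLeg (GridPoint L N)) ((q, 0), 1)) := by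
  rw [iterDeriv_two_gridWord_mul_gridWord_down p q hpq, map_neg, gaussExpect_genPairProd ℂ C _ _ (fun i j => hcharge _ _ (by
    fin_cases i <;> fin_cases j <;> rfl)), Matrix.det_fin_three]
  have z01 : contr ℂ C (((p, 0), 0) : GridLeg (GridPoint L N)) ((p, 1), 1) = 0 := hspin _ _ (by simp)
  have z10 : contr ℂ C (((q, 1), 0) : GridLeg (GridPoint L N)) ((p, 0), 1) = 0 := hspin _ _ (by simp)
  have z12 : contr ℂ C (((q, 1), 0) : GridLeg (GridPoint L N)) ((q, 0), 1) = 0 := hspin _ _ (by simp)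
  have z21 : contr ℂ C (((q, 0), 0) : GridLeg (GridPoint L N)) ((p, 1), 1) = 0 := hspin _ _ (by simp)
  simp only [Matrix.of_apply, Matrix.cons_val_zero, Matrix.cons_val_one, Matrix.cons_val_two, Matrix.head_cons, Matrix.tail_cons,
    z01, z10, z12, z21]
  ring

/-- **Both spins at once** (`σ.rev` is the other spin): `∫dμ_C ∂_{ψ⁻_{qσ}}∂_{ψ⁺_{pσ}}(w_p w_q) =
A(qσ⁺,pσ⁻)·(A(pσ̄⁺,qσ̄⁻)A(qσ̄⁺,pσ̄⁻) − A(pσ̄⁺,pσ̄⁻)A(qσ̄⁺,qσ̄⁻))`. -/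
theorem gaussExpect_iterDeriv_two_gridWord_mul_gridWord (p q : GridPoint L N) (hpq : p ≠ q) (σ : Fin 2) :
    gaussExpect ℂ C (iterDeriv ℂ ![(((p, σ), 0) : GridLeg (GridPoint L N)), ((q, σ), 1)] (gridWord L N p * gridWord L N q)) =
      contr ℂ C (((q, σ), 0) : GridLeg (GridPoint L N)) ((p, σ), 1) *
        (contr ℂ C (((p, σ.rev), 0) : GridLeg (GridPoint L N)) ((q, σ.rev), 1) *
            contr ℂ C (((q, σ.rev), 0) : GridLeg (GridPoint L N)) ((p, σ.rev), 1) -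
          contr ℂ C (((p, σ.rev), 0) : GridLeg (GridPoint L N)) ((p, σ.rev), 1) *
            contr ℂ C (((q, σ.rev), 0) : GridLeg (GridPoint L N)) ((q, σ.rev), 1)) := by
  fin_cases σ
  · exact gaussExpect_iterDeriv_two_gridWord_mul_gridWord_up C hcharge hspin p q hpq
  · exact gaussExpect_iterDeriv_two_gridWord_mul_gridWord_down C hcharge hspin p q hpq

end Wick

end Summit.HubbardSuperconductivity.HubbardSuperconductivity.Theorems.KLRegimeSplit

end
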